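import Summits.BirchSwinnertonDyer.BirchSwinnertonDyer.Theorems.SylvesterTwoHeegnerIndexCoupledTelescopeLagrangian
import Summits.BirchSwinnertonDyer.BirchSwinnertonDyer.Theorems.SylvesterTwoHeegnerIndexShaDescentPackage
import Literature.NumberTheory.EllipticCurves.CasselsTateResCorAdjoint
import Literature.GroupTheory.FiniteAbelian.SymplecticModules
import HarnessLib

/-!
# The COUPLED Cassels–Tate telescope, VIII: the (T-L4) LAGRANGIAN ON THE TREE'S `Ш` — a coisotropic,
# isotropic `𝒪`-submodule `D = r(L) ⊔ w·r(L)` of `Ш(E_K/K)[2^∞]` from ONE Cassels–Tate witness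

Crux `UpperOffV0HSYPlus` (stmt-BirchSwinnertonDyer-19804), VARIANT M stubs `stub_tailFour` /
`stub_tailSeven`, census theorems `…CoupledTelescopeTailFour/Seven` (p699147 / #K4): their display hT
asks per curve `X` for (T-L4) «a bi-additive `ℚ/ℤ`-valued `B_X` on `primaryComponent (Ш X_K) 2` and a
COISOTROPIC `D_X`» (+ the telescope's isotropy of the lifts).  This file DISCHARGES that pairing/subgroup
part on the tree's genuine objects for every `j = 0` short model `E = ⟨0,0,0,0,b⟩/ℚ` (= `cubeSumCurve ·`)
over a quadratic `K ∋ ω`, under the planner's ONE-WITNESS RULE (D576): the pairings come from ONE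
obtain of the named fact `casselsTate_pairing_resCor K σ₀ h2 hσ₀` (Fisher 2003 Prop. 2.16 form, k-ty1
g10 #26 p697672, debt +1 of record) through k-ty1's ★ `exists_casselsTate_resCor_package`, fed with
the ONE-`w` descent datum `(φ, r, w, s)` of `…ShaDescentPackage.exists_descent_package` (#K7), and the
algebra is `…CoupledTelescopeLagrangian` (#K6):

* `exists_coisotropic_lagrangian_sha` — for `E = ⟨0,0,0,0,b⟩` elliptic, `K` with `ω² + ω + 1 = 0`,
  `finrank ℚ K = 2`, an involution `σ₀` with `σ₀ ω = ω²`, `σ₀ ≠ 1`, the fact `hRC`, and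
  `Ш(E/ℚ)[2^∞]` finite: THERE ARE the Cassels–Tate pairing `B₂` on `Ш(E_K/K)[2^∞]` (alternating,
  antisymmetric, `𝒪`-balanced for `w`, non-degenerate when `Ш(E_K)[2^∞]` is finite), the descent datum
  `r` (= `shaRestriction` on `Ш(E/ℚ)[2^∞]`), `w` (`w² + w + 1 = 0`, `(c,d) ↦ r c + w (r d)` bijective),
  and a LAGRANGIAN `L ≤ Ш(E/ℚ)[2^∞]` of the `ℚ`-side pairing (`(#L)² = #Ш(E/ℚ)[2^∞]`) such that
  `D := closure (r(L) ∪ w '' r(L))` is ISOTROPIC and COISOTROPIC for `B₂` — i.e. hT's (coiso) clause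
  with its provenance, and the isotropy the rows' `hiso` needs, McCallum p. 288 «choose a maximal
  isotropic subgroup `D`» realised as `D₀ ⊗ 𝒪` (memo two §59.1 (iii), §64.5 SET-UP).

What stays for the rows after this file: the LIFTS of a `ℤ`-basis of `L` through
`Sel_{2^M}(E_K) → Ш(E_K)[2^M]` (#K5 `exists_lift_pow_smul_eq_zero` + the tree's Kummer exactness) for
hT's (gen)/`hind`/`hN'`, the finiteness of `Ш(E/ℚ)[2^∞]` from the tail's guard, and (T-L1)–(T-L3),
(T-L5).  Theorem-only (no definition, no named fact); `hRC` is the ONLY named-fact hypothesis; nothing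
asserted on 19804; BSD not claimed for any curve.  Sources: McCallum 1991 §5 p. 288; Fisher 2003
Prop. 2.16; MEMO-bsd-cm-two §57.1, §59.1 (iii), §64.0/§64.5.
-/

-- every Summits module is named `Summit.<Summit>.<Problem>…`: the duplicated component is by design
set_option linter.dupNamespace false
set_option autoImplicit false

noncomputable section

open scoped Classical

open WeierstrassCurve Literature.NumberTheory.EllipticCurves
  Literature.NumberTheory.GaloisRepresentations NumberField

namespace Summit.BirchSwinnertonDyer.BirchSwinnertonDyer.Theorems.SylvesterTwoCoupledTelescope

set_option maxHeartbeats 800000 in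
/-- **(T-L4), pairing/subgroup part, ON THE TREE'S `Ш` from ONE Cassels–Tate witness** (see the module
docstring): for `E = ⟨0,0,0,0,b⟩/ℚ`, `K ∋ ω` quadratic, `σ₀` the non-trivial involution with
`σ₀ ω = ω²`, the named fact `hRC : casselsTate_pairing_resCor K σ₀ h2 hσ₀` and `Ш(E/ℚ)[2^∞]` finite,
there are `B₂, r, w, L` with: `B₂` alternating / antisymmetric / `𝒪`-balanced / non-degenerate (under
finiteness of `Ш(E_K)[2^∞]`); `↑(r c) = shaRestriction E K c`; `w² + w + 1 = 0`;
`(c, d) ↦ r c + w (r d)` bijective; `L` a Lagrangian of the `ℚ`-side pairing with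
`(#L)² = #Ш(E/ℚ)[2^∞]`; and `D = closure (r(L) ∪ w '' r(L))` ISOTROPIC and COISOTROPIC for `B₂`.
[cite: McCallumLMS1991, §5 (p. 288)] -/
theorem exists_coisotropic_lagrangian_sha {K : Type} [Field K] [NumberField K] {b : ℚ}
    [(⟨0, 0, 0, 0, b⟩ : WeierstrassCurve ℚ).IsElliptic] {ω : K} (hω : ω ^ 2 + ω + 1 = 0)
    (h2 : Module.finrank ℚ K = 2) (σ₀ : K ≃ₐ[ℚ] K) (hσω : σ₀ ω = ω ^ 2) (hσ2 : σ₀ * σ₀ = 1)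
    (hσ₀ : σ₀ ≠ 1) (hRC : casselsTate_pairing_resCor K σ₀ h2 hσ₀)
    [Finite (AddCommGroup.primaryComponent (⟨0, 0, 0, 0, b⟩ : WeierstrassCurve ℚ).sha 2)] :
    ∃ (B₂ : AddCommGroup.primaryComponent ((⟨0, 0, 0, 0, b⟩ : WeierstrassCurve ℚ).baseChange K).sha 2
          →+ AddCommGroup.primaryComponent ((⟨0, 0, 0, 0, b⟩ : WeierstrassCurve ℚ).baseChange K).sha 2
          →+ AddCircle (1 : ℚ))
      (r : AddCommGroup.primaryComponent (⟨0, 0, 0, 0, b⟩ : WeierstrassCurve ℚ).sha 2 →+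
        AddCommGroup.primaryComponent ((⟨0, 0, 0, 0, b⟩ : WeierstrassCurve ℚ).baseChange K).sha 2)
      (w : AddCommGroup.primaryComponent ((⟨0, 0, 0, 0, b⟩ : WeierstrassCurve ℚ).baseChange K).sha 2
        →+ AddCommGroup.primaryComponent ((⟨0, 0, 0, 0, b⟩ : WeierstrassCurve ℚ).baseChange K).sha 2)
      (L : AddSubgroup (AddCommGroup.primaryComponent (⟨0, 0, 0, 0, b⟩ : WeierstrassCurve ℚ).sha 2)),
      (∀ a, B₂ a a = 0) ∧ (∀ a c, B₂ c a = -(B₂ a c)) ∧ (∀ a c, B₂ (w a) c = B₂ a (-c - w c)) ∧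
      (Finite (AddCommGroup.primaryComponent
          ((⟨0, 0, 0, 0, b⟩ : WeierstrassCurve ℚ).baseChange K).sha 2) →
        (∀ a, (∀ c, B₂ a c = 0) → a = 0) ∧ (∀ c, (∀ a, B₂ a c = 0) → c = 0)) ∧
      (∀ c, ((r c : AddCommGroup.primaryComponent
          ((⟨0, 0, 0, 0, b⟩ : WeierstrassCurve ℚ).baseChange K).sha 2) :
        ((⟨0, 0, 0, 0, b⟩ : WeierstrassCurve ℚ).baseChange K).sha) =
          shaRestriction (⟨0, 0, 0, 0, b⟩ : WeierstrassCurve ℚ) K c) ∧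
      (∀ x, w (w x) + w x + x = 0) ∧
      (Function.Bijective fun cd : AddCommGroup.primaryComponent
          (⟨0, 0, 0, 0, b⟩ : WeierstrassCurve ℚ).sha 2 ×
        AddCommGroup.primaryComponent (⟨0, 0, 0, 0, b⟩ : WeierstrassCurve ℚ).sha 2 ↦
          r cd.1 + w (r cd.2)) ∧
      Nat.card L ^ 2 = Nat.card (AddCommGroup.primaryComponent
        (⟨0, 0, 0, 0, b⟩ : WeierstrassCurve ℚ).sha 2) ∧
      (∀ s ∈ AddSubgroup.closure ((r '' (L : Set _)) ∪ w '' (r '' (L : Set _))),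
        ∀ t ∈ AddSubgroup.closure ((r '' (L : Set _)) ∪ w '' (r '' (L : Set _))), B₂ s t = 0) ∧
      (∀ t, (∀ s ∈ AddSubgroup.closure ((r '' (L : Set _)) ∪ w '' (r '' (L : Set _))), B₂ t s = 0) →
        t ∈ AddSubgroup.closure ((r '' (L : Set _)) ∪ w '' (r '' (L : Set _)))) := by
  -- the CM field data
  obtain ⟨hζ, hK, -⟩ := JZero.exists_aut_apply_eq_sq K hω h2
  haveI : ((⟨0, 0, 0, 0, b⟩ : WeierstrassCurve ℚ).baseChange K).IsElliptic :=
    inferInstanceAs ((⟨0, 0, 0, 0, b⟩ : WeierstrassCurve ℚ).map (algebraMap ℚ K)).IsElliptic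
  -- the ONE-`w` descent datum `(φ, r, w, s)` (#K7)
  obtain ⟨φ, r, w, s, hr, hwφ, hs, hw, -, hsw, -, -, -, -, hbij⟩ :=
    SylvesterTwoShaDescentOrderForm.exists_descent_package (⟨0, 0, 0, 0, b⟩ : WeierstrassCurve ℚ) K hK
      hσ2 rfl rfl rfl rfl h2 hζ hσω
  -- ONE Cassels–Tate witness: k-ty1's package on this `(φ, w, s)`
  have hinj : Function.Injective (resBaseChange (⟨0, 0, 0, 0, b⟩ : WeierstrassCurve ℚ) K) :=
    JZero.resBaseChange_injective_of_isPrimitiveRoot (⟨0, 0, 0, 0, b⟩ : WeierstrassCurve ℚ) K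
      rfl rfl rfl rfl h2 hζ hσω
  obtain ⟨Bℚ₂, B₂, res₂, hres₂, ⟨haltℚ, -, hndℚ⟩, ⟨halt₂, hanti₂, -, hbal, hnd₂⟩, h2B, hwB⟩ :=
    exists_casselsTate_resCor_package hRC (⟨0, 0, 0, 0, b⟩ : WeierstrassCurve ℚ) φ w hwφ hw
      (isLiftOfAut_liftAut σ₀) s hs hsw hinj
  -- `res₂ = r` (both lie over `shaRestriction`)
  have hres : res₂ = r := by
    ext c : 1
    exact Subtype.ext ((hres₂ c).trans (hr c).symm)
  subst hres
  -- a Lagrangian of the `ℚ`-side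
  obtain ⟨L, hLiso, hLco, hLcard⟩ :=
    Literature.GroupTheory.FiniteAbelian.exists_lagrangian_sq_eq_card Bℚ₂ haltℚ (hndℚ inferInstance).1
  -- the algebra of #K6
  have hw' : ∀ x, w (w x) = -x - w x := fun x ↦ by
    have := hw x
    rw [← sub_eq_zero]
    rw [← this]
    abel
  have hrr : ∀ a c, B₂ (res₂ a) (res₂ c) = (2 : ℤ) • Bℚ₂ a c := fun a c ↦ by
    rw [h2B, two_zsmul, two_nsmul]
  have hsurj : ∀ m, ∃ c d, m = res₂ c + w (res₂ d) := fun m ↦ by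
    obtain ⟨⟨c, d⟩, hcd⟩ := hbij.2 m
    exact ⟨c, d, hcd.symm⟩
  have hprim : ∀ c : AddCommGroup.primaryComponent (⟨0, 0, 0, 0, b⟩ : WeierstrassCurve ℚ).sha 2,
      ∃ k : ℕ, ((2 : ℤ) ^ k) • c = 0 := fun c ↦ by
    obtain ⟨k, hk⟩ := AddCommGroup.mem_primaryComponent.mp c.2
    refine ⟨k, Subtype.ext ?_⟩
    have : (((2 : ℤ) ^ k) • c : AddCommGroup.primaryComponent _ 2).1 = (2 ^ k : ℕ) • (c : _) := by
      rw [AddSubgroupClass.coe_zsmul, ← natCast_zsmul]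
      norm_cast
    rw [this, hk]
    rfl
  refine ⟨B₂, res₂, w, L, halt₂, hanti₂, hbal, hnd₂, hres₂, hw, hbij, hLcard,
    isotropic_closure_descent Bℚ₂ B₂ res₂ w hw' hbal hrr hwB L hLiso,
    coisotropic_closure_descent Bℚ₂ B₂ res₂ w hw' hbal hrr hwB hsurj hprim L hLco⟩

end Summit.BirchSwinnertonDyer.BirchSwinnertonDyer.Theorems.SylvesterTwoCoupledTelescope

end
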